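import Summits.QuantumFields.BalabanUV.T4Continuum.Support.B13HistInsertionRate
import Summits.QuantumFields.BalabanUV.T4Continuum.Support.InsertionLinearClassLoc

/-!
# B13HistInsertionLoc — row O1-c (HISTORY ∕ TABLES) of the NE5 crux O1, follower: the finite-rank kernel class with
# PER-READ-OUT (localized) kernel budgets and kernel rate — W3 (`InsScaleBound`), leaf L03 + `BaseBudget` and W4
# (`InsertionRate`) from the AGE-FREE kernel binders taken ALONG A NORMING FAMILY OF READ-OUTS of the history space
# (owner ruling R22 and the owner's booked successor item (g30-g); cell `pub-balaban`, T⁴ fan-out, `HOME/BINDER-OWNERS.md` row NE5)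

Unit `b2b-balaban-t4-ne5-formalise-leaf-04` (NE5 formalisation swarm, leaf prover 04, gen 2), for the owner lineage t4-ne5-p1's
successor list (HANDOFF gen 30, ADDENDUM 2; owner RULING R26, journal l.12164: ONE filing by leaf-04, cross-read by the row O1-c holder
leaf-06, whose `B13HistInsertion` ∕ `B13HistInsertionRate` structures this follower instances).  Summits-side NEW WORK under the LEAN PLACEMENT RULE (cell modelling + bookkeeping; nothing
of the manuscripts under audit is asserted; 0 cite tags).  HONEST FRAMING: rung (B)+1 of the FINITE-VOLUME T⁴ continuum programme — NOT
infinite volume, NOT a mass gap, NOT the Clay problem, NOT a proof of NE5 (NOT PRINTED; cell GAPS G-t4-U3-1; spine 0/9 unchanged).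
HONEST DEPENDENCY (cell line, verbatim): continuum YM on T⁴ ⇐ BetaPertH ∧ nine spine estimates (0/9 proved); BetaPertH ⇐ (D1) ∧ (D4) ∧
CAP+tail; G-an2-4 gates asym, D1 and NE2/3/4.

WHY (owner finding R22, gen 30, applied to the finite-rank kernel class of `B13HistInsertion` §2 ∕ `B13HistInsertionRate`).  The three
displayed AGE-FREE kernel binders of the class — `KernelDatum.KerBudget κ c` (run A, feeding W3 through `AgeBudget`∕`SliceBudget`), its
run-B use for leaf L03, and `KernelDatum.KerRate κ δv θ` (feeding W4 through `VecRate`) — bound `Σ_{Y ∈ fibre k j} e^{−κd(Y)}‖ker k a Y‖`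
resp. `Σ … ‖ker_A − ker_B‖`: weighted ℓ¹ sums of HIST-NORMS over all earlier domains of one scale.  On the history space of record
(`B13HistDatum.Hist F`, bounded tables with the weighted SUP norm) each kernel vector is supported on the entries near its domain, so
the read-out of the kernel SUM at one entry is a LOCAL sum, while the sum of the sup norms grows with the NUMBER of earlier domains —
the displayed `c`, `δv` would be volume-extensive (the owner's witness `InsertionLinearClassLocWitness`: the global budget forces
`c ≥ N`, the local one holds with `c = 1`).  REMEDY (as R22): take the three binders ALONG A NORMING FAMILY `ρ : E → (Hist →L[ℂ] ℂ)`
(`InsertionLinearClassLoc.Norming`; for the Hist of record the point evaluations, `norming_evalCLM`) — `KerBudgetLoc`, `KerBudgetBLoc`,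
`KerRateLoc` bound `Σ_Y e^{−κd(Y)}‖ρ e (ker …)‖` FOR EACH read-out `e` — and feed R22's per-read-out consumers BY NAME.

WHAT THIS MODULE IS (bookkeeping∕[folklore]; all conclusions are the tree's shapes BY NAME, no END face restated):
* §1 shapes `KerBudgetLoc K M W κ c ρ` (run A), `KerBudgetBLoc K M W κ c ρ` (run B), `KerRateLoc K M W κ δv θ ρ`; bridges
  `kerBudgetLoc_of_kerBudget`, `kerRateLoc_of_kerRate` (global ⟹ local along read-outs of norm ≤ 1; the converse is unavailable —
  that is the point).
* §2 W3: `ageBudgetLoc_linA_of_kerBudgetLoc` (⟹ R22's `AgeBudgetLoc K.linA M W κ c ω ρ`: the age factor inside `vec` comes out of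
  each fibre, read-out by read-out), `norm_slice_le_of_loc` ⟹ `sliceBudget_of_kerBudgetLoc` (⟹ the P1 model's Hist-norm binder `InsDatum.SliceBudget`
  itself — `hbA` of E1[rec] —, by the localized triangle inequality; the row holder's ANNEX-E precision point) and its run-B twin
  `norm_sliceB_le_of_kerBudgetBLoc` (the body of the assembled END faces' `SliceBudgetB`, `hbB`), `insScaleBoundLevel_of_kerBudgetLoc` ∕
  `insScaleBound_of_kerBudgetLoc` ∕ `insertion_binders_of_kerBudgetLoc` (⟹ `StepModel.InsScaleBoundLevel`∕`InsScaleBound` + the three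
  structural binders BY NAME, through `insScaleBoundLevel_of_ageBudgetLoc` and `Norming`).
* §3 leaf L03: `ageBudgetLoc_linB_of_kerBudgetBLoc`, `inBase_baseBudget_of_selfCtr_kerBudgetBLoc` (L03 ∧ `BaseBudget` for the
  self-centred installed model from run B's LOCAL kernel budget, through `inBase_baseBudget_of_selfCtr_ageBudgetLoc`).
* §4 W4: `vecRateLoc_of_kerRateLoc` (⟹ `VecRateLoc K.linA (linB K) M W κ (δv(1 − ω)⁻¹) θ ρ` — fibre decomposition, age factor
  out of each fibre, geometric tail, for each read-out: `B13HistInsertionRate.vecRate_of_kerRate` localized) and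
  `insertionRate_of_kernelRatesLoc` (⟹ `M.InsertionRate W κ E₀ (δb + E₀·δv(1 − ω)⁻¹) θ` through `insertionRate_of_linearLoc`).
* §5 the Hist of record: on any space of bounded tables `α →ᵇ ℂ` (the record's `B13HistDatum.Hist F = Entry F →ᵇ ℂ` is one) the
  three consumers with `ρ := evalCLM`, `Norming` discharged by `norming_evalCLM` — constants PER ENTRY.

STATUS (census, Edison rule).  Bookkeeping; discharges NO wall and NO estimate of [II]; changes NO census value except the READING of
the finite-rank class's `c` (W3 ∕ L03) and `δv` (W4): per read-out, volume-uniform on the Hist of record.  No claim that Bałaban's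
insertion is finite-rank (MODELLING NOTE of `B13HistInsertion`).  NOT HERE: the dictionary from `evalCLM` read-outs to the PHYSICAL
entries `HistFrame.read` of `B13HistDatum` (weight × stored value — the currency in which [II] (1.36) is printed, per entry against
its level format) — the row holder's announced follower; a toy non-vacuity witness of the three shapes — a separate module.  NE5 NOT PROVED; 0/12 leaves on Bałaban's concrete objects; spine 0/9;
rung (B)+1 finite T⁴; NOT infinite volume ∕ mass gap ∕ Clay.  0 sorry; axioms ⊆ {propext, Classical.choice, Quot.sound}.
-/

noncomputable section

open scoped BigOperators
open Finset

namespace Summit.QuantumFields.BalabanUV.T4Continuum.B13HistInsertionLoc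

open Literature.MathematicalPhysics.QuantumFieldTheory.Balaban1983to89
open Literature.MathematicalPhysics.QuantumFieldTheory.Balaban1983to89.T4OutputRate (Carriers Functional DecayBound)
open Literature.MathematicalPhysics.QuantumFieldTheory.Balaban1983to89.T4InputCauchyRateData (StepModel)
open Literature.MathematicalPhysics.QuantumFieldTheory.Balaban1983to89.T4InputCauchyRateSpecies (BaseBudget)
open Summit.QuantumFields.BalabanUV.T4Continuum.InsertionLinearClass (LinearInsertion)
open Summit.QuantumFields.BalabanUV.T4Continuum.InsertionLinearRate (LinearPair.BaseRate)
open Summit.QuantumFields.BalabanUV.T4Continuum.InsertionLinearClassLoc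
open Summit.QuantumFields.BalabanUV.T4Continuum.B13Base (selfCtr selfBudgetBase)
open Summit.QuantumFields.BalabanUV.T4Continuum.B13HistInsertion
open Summit.QuantumFields.BalabanUV.T4Continuum.B13HistInsertionRate (sum_age_le)
open Summit.QuantumFields.BalabanUV.T4Continuum.B13HistInsertionRate.KernelDatum (linB readsB_linB_iff linA_dom_eq_linB_dom)

variable {C : Carriers} {IOp Op Hist : Type*} [NormedAddCommGroup Op] [NormedSpace ℂ Op] [NormedAddCommGroup Hist]
  [NormedSpace ℂ Hist] {E : Type*}

namespace KernelDatum

/-! ## §1 The per-read-out kernel binders and the bridges from the global ones -/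

section Shapes

variable (K : KernelDatum C IOp Hist)

/-- [folklore] HYPOTHESIS SHAPE `KerBudgetLoc K M W κ c ρ` — run A's AGE-FREE kernel budget PER READ-OUT (`B13HistInsertion.KernelDatum.KerBudget`
with `‖ker‖` replaced by `‖ρ e (ker)‖`, for every read-out `e`; printed KIND: the age bookkeeping of [II] p. 8 ∕ (1.24), (1.36), which
bounds the contribution of the scale-`j` earlier domains to ONE entry of the potential table; NOT PRINTED as a statement about kernel
vectors): at step `k` and run A's datum, for every read-out `e`, the `e^{−κd}`-weighted sum over the scale-`j` fibre of `‖ρ e (ker k a Y)‖`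
is at most `c` history margins. -/
def KerBudgetLoc (M : StepModel C Op Hist) (W : Set (ℕ → ℝ)) (κ c : ℝ) (ρ : E → (Hist →L[ℂ] ℂ)) : Prop :=
  ∀ k, ∀ g ∈ W, ∀ (U : C.BgB) (j : ℕ), j < k → ∀ e : E,
    ∑ Y ∈ K.fibre k j, Real.exp (-(κ * C.d Y)) * ‖ρ e (K.ker k (K.insOpA g U k) Y)‖ ≤ M.rHist k * c

/-- [folklore] HYPOTHESIS SHAPE `KerBudgetBLoc K M W κ c ρ` — the run-B twin of `KerBudgetLoc` (run B's insertion-operator datum;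
this is the per-read-out kernel budget that feeds leaf L03 through run B's age budget, §3). -/
def KerBudgetBLoc (M : StepModel C Op Hist) (W : Set (ℕ → ℝ)) (κ c : ℝ) (ρ : E → (Hist →L[ℂ] ℂ)) : Prop :=
  ∀ k, ∀ g ∈ W, ∀ (U : C.BgB) (j : ℕ), j < k → ∀ e : E,
    ∑ Y ∈ K.fibre k j, Real.exp (-(κ * C.d Y)) * ‖ρ e (K.ker k (K.insOpB g U k) Y)‖ ≤ M.rHist k * c

/-- [folklore] HYPOTHESIS SHAPE `KerRateLoc K M W κ δv θ ρ` — the NE2-TYPE two-spacing rate of the AGE-FREE kernels PER READ-OUT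
(`B13HistInsertionRate.KernelDatum.KerRate` with `‖ker_A − ker_B‖` replaced by `‖ρ e (ker_A − ker_B)‖`, for every read-out `e`;
displayed; NOT PRINTED — node U1a's currency): at step `k`, for every `j < k` and every read-out `e`, the `e^{−κd}`-weighted sum over
the scale-`j` fibre of the read-out discrepancy of the two runs' kernel vectors is at most `δv·θ^k` history margins. -/
def KerRateLoc (M : StepModel C Op Hist) (W : Set (ℕ → ℝ)) (κ δv θ : ℝ) (ρ : E → (Hist →L[ℂ] ℂ)) : Prop :=
  ∀ k, ∀ g ∈ W, ∀ (U : C.BgB) (j : ℕ), j < k → ∀ e : E,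
    ∑ Y ∈ K.fibre k j, Real.exp (-(κ * C.d Y)) * ‖ρ e (K.ker k (K.insOpA g U k) Y - K.ker k (K.insOpB g U k) Y)‖ ≤
      δv * θ ^ k * M.rHist k

variable {K} {M : StepModel C Op Hist} {W : Set (ℕ → ℝ)} {ρ : E → (Hist →L[ℂ] ℂ)}

/-- [folklore] BRIDGE: the global kernel budget implies the per-read-out one along read-outs of norm `≤ 1`. -/
theorem kerBudgetLoc_of_kerBudget (hρ1 : ∀ e (h : Hist), ‖ρ e h‖ ≤ ‖h‖) {κ c : ℝ} (hb : K.KerBudget M W κ c) :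
    KerBudgetLoc K M W κ c ρ := fun k g hg U j hj e =>
  (sum_readout_le_sum_norm hρ1 (K.fibre k j) (fun Y => K.ker k (K.insOpA g U k) Y) e).trans (hb k g hg U j hj)

/-- [folklore] BRIDGE: the global kernel rate implies the per-read-out one along read-outs of norm `≤ 1`. -/
theorem kerRateLoc_of_kerRate (hρ1 : ∀ e (h : Hist), ‖ρ e h‖ ≤ ‖h‖) {κ δv θ : ℝ}
    (hr : B13HistInsertionRate.KernelDatum.KerRate K M W κ δv θ) : KerRateLoc K M W κ δv θ ρ := fun k g hg U j hj e =>
  (sum_readout_le_sum_norm hρ1 (K.fibre k j) (fun Y => K.ker k (K.insOpA g U k) Y - K.ker k (K.insOpB g U k) Y) e).trans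
    (hr k g hg U j hj)

end Shapes

/-! ## §2 W3 from run A's per-read-out kernel budget -/

section W3

variable {K : KernelDatum C IOp Hist} {M : StepModel C Op Hist} {W : Set (ℕ → ℝ)} {ρ : E → (Hist →L[ℂ] ℂ)}

/-- [folklore] The read-out of an age-weighted kernel vector: the age factor comes out (`ρ e` is ℂ-linear, `ω ≥ 0`). -/
theorem weight_mul_norm_readout_smul (hω : 0 ≤ K.ω) {κ : ℝ} (e : E) (k : ℕ) (Y : C.Dom) (v : Hist) :
    Real.exp (-(κ * C.d Y)) * ‖ρ e ((((K.ω ^ (k - 1 - C.scale Y) : ℝ) : ℂ)) • v)‖ =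
      K.ω ^ (k - 1 - C.scale Y) * (Real.exp (-(κ * C.d Y)) * ‖ρ e v‖) := by
  rw [map_smul, norm_smul, Complex.norm_real, Real.norm_eq_abs, abs_of_nonneg (pow_nonneg hω _)]
  ring

/-- [folklore] **R22's PER-READ-OUT AGE BUDGET OF RUN A'S LINEAR READING FROM THE PER-READ-OUT KERNEL BUDGET**: `KerBudgetLoc κ c ρ ∧
0 ≤ ω ⟹ AgeBudgetLoc K.linA M W κ c ω ρ` (the age factor inside `vec` comes out of each fibre sum, read-out by read-out;
`B13HistInsertion.KernelDatum.ageBudget_linA_of_kerBudget` localized). -/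
theorem ageBudgetLoc_linA_of_kerBudgetLoc {κ c : ℝ} (hb : KerBudgetLoc K M W κ c ρ) (hω : 0 ≤ K.ω) :
    AgeBudgetLoc K.linA M W κ c K.ω ρ := by
  intro k g hg U j hj e
  have hfib : ∀ Y ∈ K.fibre k j, Real.exp (-(κ * C.d Y)) * ‖ρ e (K.linA.vec g U k Y)‖ =
      K.ω ^ (k - 1 - j) * (Real.exp (-(κ * C.d Y)) * ‖ρ e (K.ker k (K.insOpA g U k) Y)‖) := fun Y hY => by
    rw [← (Finset.mem_filter.1 hY).2]
    exact weight_mul_norm_readout_smul hω e k Y _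
  calc ∑ Y ∈ (K.linA.dom k).filter (fun Y => C.scale Y = j), Real.exp (-(κ * C.d Y)) * ‖ρ e (K.linA.vec g U k Y)‖
      = ∑ Y ∈ K.fibre k j, K.ω ^ (k - 1 - j) * (Real.exp (-(κ * C.d Y)) * ‖ρ e (K.ker k (K.insOpA g U k) Y)‖) :=
        Finset.sum_congr rfl hfib
    _ = K.ω ^ (k - 1 - j) * ∑ Y ∈ K.fibre k j, Real.exp (-(κ * C.d Y)) * ‖ρ e (K.ker k (K.insOpA g U k) Y)‖ := by
        rw [Finset.mul_sum]
    _ ≤ K.ω ^ (k - 1 - j) * (M.rHist k * c) := mul_le_mul_of_nonneg_left (hb k g hg U j hj e) (pow_nonneg hω _)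
    _ = M.rHist k * (c * K.ω ^ (k - 1 - j)) := by ring

/-- [folklore] **ONE AGE-FREE SLICE FROM A PER-READ-OUT FIBRE BUDGET** (the localized triangle inequality on the slice
`Σ_{Y ∈ fibre k j} t(Y) • ker k a Y`): if, for every read-out `e`, the `e^{−κd}`-weighted fibre sum of `‖ρ e (ker k a Y)‖` is at most
`c` history margins, then a scale-`j` table with entries `≤ T·e^{−κd}` drives the slice at the datum `a` by at most `c·T` margins — for
EITHER run's insertion-operator datum `a` (used below with `a := insOpA` for the P1 binder `SliceBudget` and with `a := insOpB` for the
run-B slice bound that the assembled END faces display as `SliceBudgetB`). -/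
theorem norm_slice_le_of_loc (hρ : Norming ρ) {κ c T : ℝ} (hc : 0 ≤ c) (hT : 0 ≤ T) {k j : ℕ} {a : IOp} {t : C.Dom → ℝ}
    (hb : ∀ e : E, ∑ Y ∈ K.fibre k j, Real.exp (-(κ * C.d Y)) * ‖ρ e (K.ker k a Y)‖ ≤ M.rHist k * c)
    (hbd : ∀ Y, C.scale Y = j → |t Y| ≤ T * Real.exp (-(κ * C.d Y))) : ‖K.slice k j a t‖ ≤ M.rHist k * (c * T) := by
  rw [KernelDatum.slice]
  have hμ : 0 ≤ M.rHist k * (c * T) := mul_nonneg (M.rHist_pos k).le (mul_nonneg hc hT)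
  refine norm_sum_smul_le_of_norming hρ hμ fun e => ?_
  calc ∑ Y ∈ K.fibre k j, |t Y| * ‖ρ e (K.ker k a Y)‖
      ≤ ∑ Y ∈ K.fibre k j, T * (Real.exp (-(κ * C.d Y)) * ‖ρ e (K.ker k a Y)‖) := by
        refine Finset.sum_le_sum fun Y hY => ?_
        calc |t Y| * ‖ρ e (K.ker k a Y)‖ ≤ T * Real.exp (-(κ * C.d Y)) * ‖ρ e (K.ker k a Y)‖ :=
              mul_le_mul_of_nonneg_right (hbd Y (Finset.mem_filter.1 hY).2) (norm_nonneg _)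
          _ = T * (Real.exp (-(κ * C.d Y)) * ‖ρ e (K.ker k a Y)‖) := by ring
    _ = T * ∑ Y ∈ K.fibre k j, Real.exp (-(κ * C.d Y)) * ‖ρ e (K.ker k a Y)‖ := by rw [Finset.mul_sum]
    _ ≤ T * (M.rHist k * c) := mul_le_mul_of_nonneg_left (hb e) hT
    _ = M.rHist k * (c * T) := by ring

/-- [folklore] **THE P1 BINDER `SliceBudget` FED PER READ-OUT** (route 1 to W3 on the P1 model of record — the `hbA` binder of the
END face of record E1[rec] `B13StepEndInsOp.ne5_of_record_insOp` when `S.D := K.toInsDatum`; the row holder leaf-06's ANNEX-E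
precision point, journal l.12101): `Norming ρ ∧ KerBudgetLoc κ c ρ ∧ 0 ≤ c ⟹ K.toInsDatum.SliceBudget M W κ c` — the Hist-NORM statement
`SliceBudget` is instantiable volume-uniformly from per-entry kernel bounds (then `InsDatum.insScaleBoundLevel_of_sliceBudget` gives W3
again, the same conclusion as `insScaleBoundLevel_of_kerBudgetLoc`). -/
theorem sliceBudget_of_kerBudgetLoc (hρ : Norming ρ) {κ c : ℝ} (hb : KerBudgetLoc K M W κ c ρ) (hc : 0 ≤ c) :
    K.toInsDatum.SliceBudget M W κ c := fun k g hg U j _ _ hj hT _ hbd =>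
  norm_slice_le_of_loc hρ hc hT (fun e => hb k g hg U j hj e) hbd

/-- [folklore] **THE RUN-B SLICE BOUND FED PER READ-OUT** (the body of the assembled END faces' displayed binder `SliceBudgetB` — `hbB` of
E1[B13] ∕ E1[rec] — for an assembly whose insertion datum is `K.toInsDatum` and whose history margin is `M.rHist`):
`Norming ρ ∧ KerBudgetBLoc κ c ρ ∧ 0 ≤ c ⟹` a scale-`j < k` table with entries `≤ T·e^{−κd}` (`T ≥ 0`) drives run B's slice by at most
`rHist k·(c·T)`. -/
theorem norm_sliceB_le_of_kerBudgetBLoc (hρ : Norming ρ) {κ c : ℝ} (hb : KerBudgetBLoc K M W κ c ρ) (hc : 0 ≤ c) (k : ℕ)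
    {g : ℕ → ℝ} (hg : g ∈ W) (U : C.BgB) {j : ℕ} {T : ℝ} {t : C.Dom → ℝ} (hj : j < k) (hT : 0 ≤ T)
    (hbd : ∀ Y, C.scale Y = j → |t Y| ≤ T * Real.exp (-(κ * C.d Y))) :
    ‖K.toInsDatum.slice k j (K.toInsDatum.insOpB g U k) t‖ ≤ M.rHist k * (c * T) :=
  norm_slice_le_of_loc hρ hc hT (fun e => hb k g hg U j hj e) hbd

/-- [folklore] **W3 AT AN ARBITRARY LEVEL FOR THE FINITE-RANK CLASS, LOCALIZED**: `Norming ρ ∧ ReadsA ∧ KerBudgetLoc κ c ρ ∧ 0 ≤ c ∧ 0 ≤ ω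
⟹ M.InsScaleBoundLevel W κ c ω` BY NAME (`insScaleBoundLevel_of_ageBudgetLoc` on run A's linear reading `reads_linA_iff`). -/
theorem insScaleBoundLevel_of_kerBudgetLoc (hρ : Norming ρ) {κ c : ℝ} (h : K.toInsDatum.ReadsA M W)
    (hb : KerBudgetLoc K M W κ c ρ) (hc : 0 ≤ c) (hω : 0 ≤ K.ω) : M.InsScaleBoundLevel W κ c K.ω :=
  insScaleBoundLevel_of_ageBudgetLoc hρ ((K.reads_linA_iff M W).2 h) (ageBudgetLoc_linA_of_kerBudgetLoc hb hω) hc hω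

/-- [folklore] **W3 AT THE REFERENCE LEVEL `E₁ ≥ 0`, LOCALIZED**: ⟹ `M.InsScaleBound W κ E₁ c ω` BY NAME. -/
theorem insScaleBound_of_kerBudgetLoc (hρ : Norming ρ) {κ E₁ c : ℝ} (h : K.toInsDatum.ReadsA M W)
    (hb : KerBudgetLoc K M W κ c ρ) (hc : 0 ≤ c) (hω : 0 ≤ K.ω) (hE₁ : 0 ≤ E₁) : M.InsScaleBound W κ E₁ c K.ω :=
  insScaleBound_of_ageBudgetLoc hρ ((K.reads_linA_iff M W).2 h) (ageBudgetLoc_linA_of_kerBudgetLoc hb hω) hc hω hE₁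

/-- [folklore] **The four insertion binders of the END faces** from run A's reading of the kernels and ONE per-read-out kernel budget
(`InsAffine`, `InsBlind`, `InsHomog` by construction, `InsScaleBound` by §2). -/
theorem insertion_binders_of_kerBudgetLoc (hρ : Norming ρ) {κ E₁ c : ℝ} (h : K.toInsDatum.ReadsA M W)
    (hb : KerBudgetLoc K M W κ c ρ) (hc : 0 ≤ c) (hω : 0 ≤ K.ω) (hE₁ : 0 ≤ E₁) :
    M.InsAffine W ∧ M.InsBlind W ∧ M.InsHomog W ∧ M.InsScaleBound W κ E₁ c K.ω :=
  insertion_binders_of_reads_loc hρ ((K.reads_linA_iff M W).2 h) (ageBudgetLoc_linA_of_kerBudgetLoc hb hω) hc hω hE₁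

end W3

/-! ## §3 Leaf L03 (+ `BaseBudget`) from run B's per-read-out kernel budget -/

section L03

variable {K : KernelDatum C IOp Hist} {M : StepModel C Op Hist} {W : Set (ℕ → ℝ)} {ρ : E → (Hist →L[ℂ] ℂ)}

/-- [folklore] **R22's PER-READ-OUT AGE BUDGET OF RUN B'S LINEAR READING** from the run-B per-read-out kernel budget:
`KerBudgetBLoc κ c ρ ∧ 0 ≤ ω ⟹ AgeBudgetLoc (linB K) M W κ c ω ρ`. -/
theorem ageBudgetLoc_linB_of_kerBudgetBLoc {κ c : ℝ} (hb : KerBudgetBLoc K M W κ c ρ) (hω : 0 ≤ K.ω) :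
    AgeBudgetLoc (linB K) M W κ c K.ω ρ := by
  intro k g hg U j hj e
  have hfib : ∀ Y ∈ K.fibre k j, Real.exp (-(κ * C.d Y)) * ‖ρ e ((linB K).vec g U k Y)‖ =
      K.ω ^ (k - 1 - j) * (Real.exp (-(κ * C.d Y)) * ‖ρ e (K.ker k (K.insOpB g U k) Y)‖) := fun Y hY => by
    rw [← (Finset.mem_filter.1 hY).2]
    exact weight_mul_norm_readout_smul hω e k Y _
  calc ∑ Y ∈ ((linB K).dom k).filter (fun Y => C.scale Y = j), Real.exp (-(κ * C.d Y)) * ‖ρ e ((linB K).vec g U k Y)‖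
      = ∑ Y ∈ K.fibre k j, K.ω ^ (k - 1 - j) * (Real.exp (-(κ * C.d Y)) * ‖ρ e (K.ker k (K.insOpB g U k) Y)‖) :=
        Finset.sum_congr rfl hfib
    _ = K.ω ^ (k - 1 - j) * ∑ Y ∈ K.fibre k j, Real.exp (-(κ * C.d Y)) * ‖ρ e (K.ker k (K.insOpB g U k) Y)‖ := by
        rw [Finset.mul_sum]
    _ ≤ K.ω ^ (k - 1 - j) * (M.rHist k * c) := mul_le_mul_of_nonneg_left (hb k g hg U j hj e) (pow_nonneg hω _)
    _ = M.rHist k * (c * K.ω ^ (k - 1 - j)) := by ring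

/-- [folklore] **LEAF L03 ∧ `BaseBudget` FOR THE SELF-CENTRED INSTALLED MODEL FROM RUN B'S LOCAL KERNEL BUDGET**: install
`selfBudgetBase M (linB K) E₀ c ω`; from run B's reading of the kernels `ReadsB`, ITS per-read-out kernel budget `KerBudgetBLoc κ c ρ`
along a norming family, the printed level `DecayBound EB W E₀ κ` (L06) and the signs, BOTH `InBase` (L03) and `BaseBudget` hold for the
installed model (`inBase_baseBudget_of_selfCtr_ageBudgetLoc` BY NAME; every other END-face binder transfers from `M` unchanged,
`B13Base.withBase_binders`). -/
theorem inBase_baseBudget_of_selfCtr_kerBudgetBLoc (hρ : Norming ρ) {EB : Functional C C.BgB} {κ E₀ c : ℝ}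
    (hB : K.toInsDatum.ReadsB M W) (hb : KerBudgetBLoc K M W κ c ρ) (hdB : DecayBound EB W E₀ κ) (hE₀ : 0 ≤ E₀)
    (hc : 0 ≤ c) (hω : 0 ≤ K.ω) (hω1 : K.ω < 1) :
    (M.withBase (selfBudgetBase M (linB K) E₀ c K.ω)).InBase EB W ∧
      BaseBudget (M.withBase (selfBudgetBase M (linB K) E₀ c K.ω)) W (selfCtr M (linB K).base) 0
        fun k => E₀ * (M.rHist k * (c / (1 - K.ω))) :=
  inBase_baseBudget_of_selfCtr_ageBudgetLoc hρ ((readsB_linB_iff K M W).2 hB) (ageBudgetLoc_linB_of_kerBudgetBLoc hb hω)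
    hdB hE₀ hc hω hω1

end L03

/-! ## §4 W4 from the per-read-out kernel rate -/

section W4

variable {K : KernelDatum C IOp Hist} {M : StepModel C Op Hist} {W : Set (ℕ → ℝ)} {ρ : E → (Hist →L[ℂ] ℂ)}

/-- [folklore] **R22's PER-READ-OUT VECTOR RATE FROM THE PER-READ-OUT KERNEL RATE**: `KerRateLoc κ δv θ ρ`, `0 ≤ ω < 1`, `0 ≤ δv`,
`0 ≤ θ` ⟹ `VecRateLoc K.linA (linB K) M W κ (δv(1 − ω)⁻¹) θ ρ` (fibre decomposition, the age factor out of each fibre, geometric tail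
— for each read-out; `B13HistInsertionRate.KernelDatum.vecRate_of_kerRate` localized). -/
theorem vecRateLoc_of_kerRateLoc {κ δv θ : ℝ} (hr : KerRateLoc K M W κ δv θ ρ) (hω : 0 ≤ K.ω) (hω1 : K.ω < 1)
    (hδ : 0 ≤ δv) (hθ : 0 ≤ θ) : VecRateLoc K.linA (linB K) M W κ (δv * (1 - K.ω)⁻¹) θ ρ := by
  intro k g hg U e
  have hfib : ∀ j, ∀ Y ∈ K.fibre k j,
      Real.exp (-(κ * C.d Y)) * ‖ρ e (K.linA.vec g U k Y - (linB K).vec g U k Y)‖ =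
        K.ω ^ (k - 1 - j) *
          (Real.exp (-(κ * C.d Y)) * ‖ρ e (K.ker k (K.insOpA g U k) Y - K.ker k (K.insOpB g U k) Y)‖) :=
    fun j Y hY => by
      rw [← (Finset.mem_filter.1 hY).2]
      simp only [KernelDatum.linA, linB, ← smul_sub]
      exact weight_mul_norm_readout_smul hω e k Y _
  have hunit : 0 ≤ δv * θ ^ k * M.rHist k := mul_nonneg (mul_nonneg hδ (pow_nonneg hθ _)) (M.rHist_pos k).le
  calc ∑ Y ∈ K.linA.dom k, Real.exp (-(κ * C.d Y)) * ‖ρ e (K.linA.vec g U k Y - (linB K).vec g U k Y)‖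
      = ∑ j ∈ range k, ∑ Y ∈ K.fibre k j,
          Real.exp (-(κ * C.d Y)) * ‖ρ e (K.linA.vec g U k Y - (linB K).vec g U k Y)‖ :=
        (Finset.sum_fiberwise_of_maps_to (g := C.scale) (fun Y hY => mem_range.2 (K.dom_lt k Y hY)) _).symm
    _ = ∑ j ∈ range k, K.ω ^ (k - 1 - j) *
          ∑ Y ∈ K.fibre k j, Real.exp (-(κ * C.d Y)) * ‖ρ e (K.ker k (K.insOpA g U k) Y - K.ker k (K.insOpB g U k) Y)‖ := by
        refine Finset.sum_congr rfl fun j _ => ?_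
        rw [Finset.mul_sum]
        exact Finset.sum_congr rfl (hfib j)
    _ ≤ ∑ j ∈ range k, K.ω ^ (k - 1 - j) * (δv * θ ^ k * M.rHist k) :=
        Finset.sum_le_sum fun j hj => mul_le_mul_of_nonneg_left (hr k g hg U j (mem_range.1 hj) e) (pow_nonneg hω _)
    _ = (∑ j ∈ range k, K.ω ^ (k - 1 - j)) * (δv * θ ^ k * M.rHist k) := by rw [Finset.sum_mul]
    _ ≤ (1 - K.ω)⁻¹ * (δv * θ ^ k * M.rHist k) := mul_le_mul_of_nonneg_right (sum_age_le hω hω1 k) hunit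
    _ = δv * (1 - K.ω)⁻¹ * θ ^ k * M.rHist k := by ring

/-- [folklore] **W4 FOR THE FINITE-RANK CLASS, LOCALIZED** — from the two runs' readings, the displayed NE2-TYPE base rate and the
PER-READ-OUT kernel rate along a norming family: `Norming ρ ∧ ReadsA ∧ ReadsB ∧ BaseRate δb θ ∧ KerRateLoc κ δv θ ρ ∧ 0 ≤ ω < 1 ⟹
M.InsertionRate W κ E₀ (δb + E₀·(δv(1 − ω)⁻¹)) θ` for every level `E₀ ≥ 0` — `InsertionLinearClassLoc.insertionRate_of_linearLoc` BY NAME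
(the localized triangle inequality; no analyticity, no estimate beyond the two displayed rates). -/
theorem insertionRate_of_kernelRatesLoc (hρ : Norming ρ) {κ E₀ δb δv θ : ℝ} (hA : K.toInsDatum.ReadsA M W)
    (hB : K.toInsDatum.ReadsB M W) (hbase : LinearPair.BaseRate K.linA (linB K) M W δb θ) (hr : KerRateLoc K M W κ δv θ ρ)
    (hω : 0 ≤ K.ω) (hω1 : K.ω < 1) (hδ : 0 ≤ δv) (hθ : 0 ≤ θ) (hE₀ : 0 ≤ E₀) :
    M.InsertionRate W κ E₀ (δb + E₀ * (δv * (1 - K.ω)⁻¹)) θ :=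
  insertionRate_of_linearLoc hρ ((K.reads_linA_iff M W).2 hA) ((readsB_linB_iff K M W).2 hB) (linA_dom_eq_linB_dom K)
    hbase (vecRateLoc_of_kerRateLoc hr hω hω1 hδ hθ) hE₀ (mul_nonneg hδ (inv_nonneg.2 (sub_nonneg.2 hω1.le))) hθ

end W4

/-! ## §5 On a sup-normed space of bounded tables (the Hist of record): the consumers PER ENTRY -/

section Record

variable {α : Type*} [TopologicalSpace α] {K : KernelDatum C IOp (BoundedContinuousFunction α ℂ)}
  {M : StepModel C Op (BoundedContinuousFunction α ℂ)} {W : Set (ℕ → ℝ)}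

/-- [folklore] **W3 PER ENTRY**: on a history space of bounded tables `α →ᵇ ℂ` with the sup norm (the Hist of record
`B13HistDatum.Hist F = Entry F →ᵇ ℂ` is one), run A's reading of the kernels and the kernel budget READ AT EACH ENTRY give
`M.InsScaleBound W κ E₁ c ω` — `Norming` discharged by `norming_evalCLM`, so `c` is a PER-ENTRY constant. -/
theorem insScaleBound_of_kerBudget_eval {κ E₁ c : ℝ} (h : K.toInsDatum.ReadsA M W)
    (hb : KerBudgetLoc K M W κ c fun a : α => BoundedContinuousFunction.evalCLM ℂ a) (hc : 0 ≤ c) (hω : 0 ≤ K.ω)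
    (hE₁ : 0 ≤ E₁) : M.InsScaleBound W κ E₁ c K.ω :=
  insScaleBound_of_kerBudgetLoc norming_evalCLM h hb hc hω hE₁

/-- [folklore] **LEAF L03 ∧ `BaseBudget` PER ENTRY** for the self-centred installed model on a sup-normed table space: run B's reading,
its kernel budget READ AT EACH ENTRY, the printed level (L06) and the signs. -/
theorem inBase_baseBudget_of_selfCtr_kerBudgetB_eval {EB : Functional C C.BgB} {κ E₀ c : ℝ} (hB : K.toInsDatum.ReadsB M W)
    (hb : KerBudgetBLoc K M W κ c fun a : α => BoundedContinuousFunction.evalCLM ℂ a) (hdB : DecayBound EB W E₀ κ)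
    (hE₀ : 0 ≤ E₀) (hc : 0 ≤ c) (hω : 0 ≤ K.ω) (hω1 : K.ω < 1) :
    (M.withBase (selfBudgetBase M (linB K) E₀ c K.ω)).InBase EB W ∧
      BaseBudget (M.withBase (selfBudgetBase M (linB K) E₀ c K.ω)) W (selfCtr M (linB K).base) 0
        fun k => E₀ * (M.rHist k * (c / (1 - K.ω))) :=
  inBase_baseBudget_of_selfCtr_kerBudgetBLoc norming_evalCLM hB hb hdB hE₀ hc hω hω1

/-- [folklore] **W4 PER ENTRY**: on a sup-normed table space the two readings, the base rate and the kernel rate READ AT EACH ENTRY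
give `M.InsertionRate W κ E₀ (δb + E₀·(δv(1 − ω)⁻¹)) θ` — `δv` a PER-ENTRY constant. -/
theorem insertionRate_of_kernelRates_eval {κ E₀ δb δv θ : ℝ} (hA : K.toInsDatum.ReadsA M W) (hB : K.toInsDatum.ReadsB M W)
    (hbase : LinearPair.BaseRate K.linA (linB K) M W δb θ)
    (hr : KerRateLoc K M W κ δv θ fun a : α => BoundedContinuousFunction.evalCLM ℂ a) (hω : 0 ≤ K.ω) (hω1 : K.ω < 1)
    (hδ : 0 ≤ δv) (hθ : 0 ≤ θ) (hE₀ : 0 ≤ E₀) : M.InsertionRate W κ E₀ (δb + E₀ * (δv * (1 - K.ω)⁻¹)) θ :=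
  insertionRate_of_kernelRatesLoc norming_evalCLM hA hB hbase hr hω hω1 hδ hθ hE₀

end Record

end KernelDatum

end Summit.QuantumFields.BalabanUV.T4Continuum.B13HistInsertionLoc

end
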